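import Mathlib.GroupTheory.FreeGroup.Reduce
import Mathlib.GroupTheory.QuotientGroup.Basic
import Mathlib.GroupTheory.Index
import Mathlib.Algebra.Group.Conj
import Mathlib.Data.ZMod.Basic
import Mathlib.Algebra.Group.TypeTags.Finite
import HarnessLib

/-!
# Exponent sums in free groups: separating non-conjugate elements in abelian quotients

Topic `Literature/GroupTheory/CombinatorialGroupTheory`; theorems only.  The first, abelian step
of the proof of conjugacy separability of free groups (Lyndon–Schupp, *Combinatorial Group Theory*,
Ch. I, Prop. 4.8): *"If the images `ū` and `v̄` of `u` and `v` in `F̄ = F/[F, F]` are distinct, then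
`g = ū⁻¹v̄` … has non trivial image in [a finite] abelian group … The images of `u` and `v` in this
abelian group are then distinct and therefore not conjugate"* (`exists_normal_finiteIndex_of_expSum_ne`),
and the complementary case *"We may assume then that `ū = v̄` … Thus there exists a map … from `F`
onto `ℤ_p` [here `p = 2`] with `u` and `v` in the kernel"*, with the extra bookkeeping that the
generator `x₁` mapping onto `ℤ/2` may be chosen among the letters of `u` or `v`
(`exists_parity_of_expSum_eq`).  Exponent sums are the homomorphisms
`σⱼ : F(ι) →* ℤ`, `xⱼ ↦ 1`, `xᵢ ↦ 0` (`i ≠ j`), written multiplicatively.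

## References

* R. C. Lyndon, P. E. Schupp, *Combinatorial Group Theory*, Ergebnisse 89, Springer (1977);
  Classics in Mathematics (2001), Ch. I, proof of Prop. 4.8. [LyndonSchupp2001]
-/

namespace Literature.GroupTheory.CombinatorialGroupTheory

namespace FreeGroupExponentSums

universe u

variable {ι : Type u} [DecidableEq ι]

-- the exponent sum `σⱼ : F →* ℤ` (multiplicative notation)
set_option quotPrecheck false in
local notation3 "σ" => fun (j : ι) => (FreeGroup.lift fun i : ι =>
  (if i = j then Multiplicative.ofAdd (1 : ℤ) else (1 : Multiplicative ℤ)) :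
    FreeGroup ι →* Multiplicative ℤ)

/-- `σⱼ(xⱼ) = 1`. [folklore] -/
private theorem expSum_of_self (j : ι) : σ j (FreeGroup.of j) = Multiplicative.ofAdd 1 := by
  simp only [FreeGroup.lift_apply_of, if_true]

/-- `σⱼ(xᵢ) = 0` for `i ≠ j`. [folklore] -/
private theorem expSum_of_ne {i j : ι} (h : i ≠ j) : σ j (FreeGroup.of i) = 1 := by
  simp only [FreeGroup.lift_apply_of, h, if_false]

/-- A word all of whose letters are `xₐ^{±1}` is the power `xₐ^{σₐ}`. [folklore] -/
private theorem mk_eq_of_zpow_of_forall_fst_eq (a : ι) :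
    ∀ L : List (ι × Bool), (∀ p ∈ L, p.1 = a) →
      FreeGroup.mk L = FreeGroup.of a ^ Multiplicative.toAdd (σ a (FreeGroup.mk L)) := by
  intro L
  induction L with
  | nil => intro _; rw [← FreeGroup.one_eq_mk, _root_.map_one, toAdd_one, zpow_zero]
  | cons p L ih =>
      intro hL
      obtain ⟨i, b⟩ := p
      have hi : i = a := hL (i, b) (List.mem_cons_self ..)
      subst i
      have hcons : FreeGroup.mk ((a, b) :: L) = FreeGroup.mk [(a, b)] * FreeGroup.mk L := by
        rw [FreeGroup.mul_mk]; rfl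
      have hL' : ∀ p ∈ L, p.1 = a := fun p hp => hL p (List.mem_cons_of_mem _ hp)
      have ih' := ih hL'
      rw [hcons, _root_.map_mul, toAdd_mul, zpow_add, ← ih']
      cases b
      · have h1 : FreeGroup.mk [(a, false)] = (FreeGroup.of a)⁻¹ := rfl
        rw [h1, _root_.map_inv, expSum_of_self, toAdd_inv, toAdd_ofAdd, zpow_neg, zpow_one]
      · have h1 : FreeGroup.mk [(a, true)] = FreeGroup.of a := rfl
        rw [h1, expSum_of_self, toAdd_ofAdd, zpow_one]

/-- If all letters of `u` and of `v` are `xₐ^{±1}` and `σₐ(u) = σₐ(v)` then `u = v`. [folklore] -/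
private theorem eq_of_forall_fst_eq {u v : FreeGroup ι} (a : ι) (hu : ∀ p ∈ u.toWord, p.1 = a)
    (hv : ∀ p ∈ v.toWord, p.1 = a) (h : σ a u = σ a v) : u = v := by
  rw [← FreeGroup.mk_toWord (x := u), ← FreeGroup.mk_toWord (x := v),
    mk_eq_of_zpow_of_forall_fst_eq a _ hu, mk_eq_of_zpow_of_forall_fst_eq a _ hv,
    FreeGroup.mk_toWord, FreeGroup.mk_toWord, h]

/-- **Distinct exponent sums separate in a finite abelian quotient**: if `σⱼ(u) ≠ σⱼ(v)` for some
letter `j`, there is a normal subgroup of finite index `K` (the kernel of `σⱼ mod m`,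
`m = |σⱼ(u) − σⱼ(v)| + 1`) such that the images of `u` and `v` in `F ⧸ K` are not conjugate.
[cite: LyndonSchupp2001, Ch. I Prop. 4.8 proof] -/
theorem exists_normal_finiteIndex_of_expSum_ne {u v : FreeGroup ι} (j : ι) (h : σ j u ≠ σ j v) :
    ∃ (K : Subgroup (FreeGroup ι)) (_ : K.Normal), K.FiniteIndex ∧
      ¬ IsConj (QuotientGroup.mk u : FreeGroup ι ⧸ K) (QuotientGroup.mk v) := by
  set d : ℤ := Multiplicative.toAdd (σ j u) - Multiplicative.toAdd (σ j v) with hd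
  have hd0 : d ≠ 0 := by
    intro h0
    apply h
    have : Multiplicative.toAdd (σ j u) = Multiplicative.toAdd (σ j v) := by omega
    exact Multiplicative.toAdd.injective this
  set m : ℕ := d.natAbs + 1 with hm
  haveI : NeZero m := ⟨Nat.succ_ne_zero _⟩
  let χ : Multiplicative ℤ →* Multiplicative (ZMod m) :=
    AddMonoidHom.toMultiplicative (Int.castAddHom (ZMod m))
  let φ : FreeGroup ι →* Multiplicative (ZMod m) := χ.comp (σ j)
  haveI : Finite φ.range := inferInstance
  refine ⟨φ.ker, inferInstance, inferInstance, ?_⟩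
  · intro hc
    have hc' : IsConj (φ u) (φ v) := by
      have := MonoidHom.map_isConj (QuotientGroup.kerLift φ) hc
      rwa [QuotientGroup.kerLift_mk, QuotientGroup.kerLift_mk] at this
    rw [isConj_iff_eq] at hc'
    have hcast : ((Multiplicative.toAdd (σ j u) : ℤ) : ZMod m) =
        ((Multiplicative.toAdd (σ j v) : ℤ) : ZMod m) := by
      have := congrArg Multiplicative.toAdd hc'
      exact this
    have hdz : ((d : ℤ) : ZMod m) = 0 := by
      rw [hd]; push_cast; rw [hcast, sub_self]
    rw [ZMod.intCast_zmod_eq_zero_iff_dvd] at hdz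
    have h1 := Int.le_of_dvd (Int.natAbs_pos.mpr hd0 |> Int.natCast_pos.mpr |>.trans_le le_rfl)
      ((Int.dvd_natAbs).mpr hdz)
    push_cast [hm] at h1
    omega

-- the parity homomorphism attached to `c : ι → ℤ/2`
set_option quotPrecheck false in
local notation3 "Λ" => fun (c : ι → ZMod 2) => (FreeGroup.lift fun i => Multiplicative.ofAdd (c i) :
  FreeGroup ι →* Multiplicative (ZMod 2))

/-- Reduction mod `2` of the exponent sum `σₐ` is the parity homomorphism of the indicator of `a`.
[folklore] -/
private theorem castHom_comp_expSum (a : ι) :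
    (AddMonoidHom.toMultiplicative (Int.castAddHom (ZMod 2))).comp (σ a) =
      Λ (fun i => if i = a then 1 else 0) := by
  refine FreeGroup.ext_hom _ _ (fun i => ?_)
  rw [MonoidHom.comp_apply, FreeGroup.lift_apply_of, FreeGroup.lift_apply_of]
  by_cases h : i = a
  · subst h; simp
  · simp [h]

/-- **Equal exponent sums give an index-two subgroup containing `u` and `v`**: if `u, v` are not
conjugate but `σⱼ(u) = σⱼ(v)` for every letter `j`, there is a parity assignment `c : ι → ℤ/2`
whose induced homomorphism `λ : F ↠ ℤ/2` kills `u` and `v`, together with a letter `x₁` OCCURRING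
in `u` or in `v` with `c x₁ = 1` (Lyndon–Schupp: *"there exists a map `φ̄` from `F̄` onto `ℤ` with
`ū = v̄` in its kernel … `x₁φ` generates `ℤ_p`"*, plus *"each generator occurs in `u` or in `v`"*).
[cite: LyndonSchupp2001, Ch. I Prop. 4.8 proof] -/
theorem exists_parity_of_expSum_eq {u v : FreeGroup ι} (huv : ¬ IsConj u v)
    (hall : ∀ j : ι, σ j u = σ j v) :
    ∃ (c : ι → ZMod 2) (x₁ : ι), Λ c u = 1 ∧ Λ c v = 1 ∧ c x₁ = 1 ∧
      x₁ ∈ u.toWord.map Prod.fst ++ v.toWord.map Prod.fst := by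
  set S := u.toWord.map Prod.fst ++ v.toWord.map Prod.fst with hS
  -- every letter of `u` or `v` lies in `S`
  have huS : ∀ p ∈ u.toWord, p.1 ∈ S := fun p hp =>
    List.mem_append_left _ (List.mem_map.mpr ⟨p, hp, rfl⟩)
  have hvS : ∀ p ∈ v.toWord, p.1 ∈ S := fun p hp =>
    List.mem_append_right _ (List.mem_map.mpr ⟨p, hp, rfl⟩)
  -- the mod-2 exponent sums
  let χ : Multiplicative ℤ →* Multiplicative (ZMod 2) :=
    AddMonoidHom.toMultiplicative (Int.castAddHom (ZMod 2))
  have hχ : ∀ z : Multiplicative ℤ, χ z = Multiplicative.ofAdd ((Multiplicative.toAdd z : ℤ) : ZMod 2) :=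
    fun z => rfl
  have hχu : ∀ a : ι, χ (σ a u) = χ (σ a v) := fun a => by rw [hall a]
  by_cases h0 : ∃ a ∈ S, χ (σ a u) = 1
  · -- (B-i): a letter with even exponent sum
    obtain ⟨a, haS, ha⟩ := h0
    refine ⟨fun i => if i = a then 1 else 0, a, ?_, ?_, by simp, haS⟩
    · rw [← castHom_comp_expSum a, MonoidHom.comp_apply]; exact ha
    · rw [← castHom_comp_expSum a, MonoidHom.comp_apply, ← hχu a]; exact ha
  · push Not at h0
    -- every letter in `S` has odd exponent sum in `u`
    have hodd : ∀ a ∈ S, χ (σ a u) = Multiplicative.ofAdd 1 := by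
      intro a ha
      have h2 : ∀ q : Multiplicative (ZMod 2), q ≠ 1 → q = Multiplicative.ofAdd 1 := by decide
      exact h2 _ (h0 a ha)
    by_cases h1 : ∃ a ∈ S, ∃ b ∈ S, a ≠ b
    · -- (B-ii): two distinct letters, both odd
      obtain ⟨a, haS, b, hbS, hab⟩ := h1
      refine ⟨fun i => (if i = a then 1 else 0) + (if i = b then 1 else 0), a, ?_, ?_, ?_, haS⟩
      · have key : Λ (fun i => (if i = a then 1 else 0) + (if i = b then 1 else 0)) =
            (χ.comp (σ a)) * (χ.comp (σ b)) := by
          refine FreeGroup.ext_hom _ _ (fun i => ?_)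
          rw [FreeGroup.lift_apply_of, MonoidHom.mul_apply, castHom_comp_expSum,
            castHom_comp_expSum, FreeGroup.lift_apply_of, FreeGroup.lift_apply_of, ofAdd_add]
        rw [key, MonoidHom.mul_apply, MonoidHom.comp_apply, MonoidHom.comp_apply, hodd a haS,
          hodd b hbS]
        decide
      · have key : Λ (fun i => (if i = a then 1 else 0) + (if i = b then 1 else 0)) =
            (χ.comp (σ a)) * (χ.comp (σ b)) := by
          refine FreeGroup.ext_hom _ _ (fun i => ?_)
          rw [FreeGroup.lift_apply_of, MonoidHom.mul_apply, castHom_comp_expSum,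
            castHom_comp_expSum, FreeGroup.lift_apply_of, FreeGroup.lift_apply_of, ofAdd_add]
        rw [key, MonoidHom.mul_apply, MonoidHom.comp_apply, MonoidHom.comp_apply, ← hχu a,
          ← hχu b, hodd a haS, hodd b hbS]
        decide
      · simp [hab]
    · -- (B-iii): all letters equal: then `u = v`, contradicting non-conjugacy
      exfalso
      push Not at h1
      by_cases hSne : S = []
      · have hu1 : u = 1 := by
          rw [← FreeGroup.toWord_eq_nil_iff]
          rcases hu' : u.toWord with _ | ⟨p, L⟩
          · rfl
          · have := huS p (by rw [hu']; exact List.mem_cons_self ..)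
            rw [hSne] at this; exact absurd this (List.not_mem_nil)
        have hv1 : v = 1 := by
          rw [← FreeGroup.toWord_eq_nil_iff]
          rcases hv' : v.toWord with _ | ⟨p, L⟩
          · rfl
          · have := hvS p (by rw [hv']; exact List.mem_cons_self ..)
            rw [hSne] at this; exact absurd this (List.not_mem_nil)
        exact huv (by rw [hu1, hv1])
      · obtain ⟨a, haS⟩ := List.exists_mem_of_ne_nil S hSne
        have hu' : ∀ p ∈ u.toWord, p.1 = a := fun p hp => (h1 _ (huS p hp) a haS)
        have hv' : ∀ p ∈ v.toWord, p.1 = a := fun p hp => (h1 _ (hvS p hp) a haS)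
        exact huv (by rw [eq_of_forall_fst_eq a hu' hv' (hall a)])

end FreeGroupExponentSums

end Literature.GroupTheory.CombinatorialGroupTheory
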